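import Summits.Ventures.HodgeRepro2.T5CyclotomicFrobenius
import Summits.Ventures.HodgeRepro2.T5DecompositionOrder
import Summits.Ventures.HodgeRepro2.T5CyclotomicDyadic

/-!
# T5CyclotomicSevenFrobenius — the EXAMPLE of row N2.2.5 in the kernel: `Frob₂ = 2 ∈ (ℤ/7)^×`

Seat p3 of the blind cell `pub-hodge-repro2` (Tier-5 support column for sub-step N2 of
`route/TIER5.md`).  Row N2.2.5 of `route/T5-N2-route-3.md` illustrates its chain on `E = ℚ(ζ₇)`:
«`Frob₂ = 2 ∈ (ℤ/7)^×` has order `3` ⟹ `D₂ = {1, 2, 4} ∌ −1 = c` ⟹ `2` is inert in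
`F⁺ = ℚ(ζ₇)⁺` … and the unique place of `F⁺` above `2` SPLITS in `E`».  For any prime `P` of
`𝓞 E` above `2`:

* under Mathlib's `Gal(E/ℚ) ≃* (ℤ/7)^×` the arithmetic Frobenius `Frob_P` goes to `2`
  (`autEquivPow_frob_two`), so `Frob_P` has order `3` (`orderOf_frob_two`) and `|D_P| = 3`
  (`card_stabilizer_two`);
* the complex conjugation `c` (the automorphism corresponding to `−1`) has order `2` and is NOT
  in `D_P` (`conj_notMem_stabilizer_two`): `c ∈ D_P` would force `2 ∣ |D_P| = 3`.

The arithmetic of `2` in `ℚ(ζ₇)` itself (`e = 1`, `f = 3`, `g = 2`; `2` inert in the cubic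
subfield, its prime split in `E`) is `T5CyclotomicDyadic` §2, imported.

Declaration of README §8(d): this file uses an L-value-free non-vanishing device: NO.
-/

namespace Summit.Ventures.HodgeRepro2.T5CyclotomicSevenFrobenius

open NumberField Ideal Polynomial
open scoped Pointwise

variable {E : Type*} [Field E] [NumberField E] [IsGalois ℚ E] [IsCyclotomicExtension {7} ℚ E]
  (P : Ideal (𝓞 E)) [P.IsPrime] [P.LiesOver (span {((2 : ℕ) : ℤ)})]

/-- The identification `Gal(E/ℚ) ≃* (ℤ/7)^×` of Mathlib (`ζ ↦ ζ^k`). -/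
noncomputable abbrev galEquiv : Gal(E/ℚ) ≃* (ZMod 7)ˣ :=
  IsCyclotomicExtension.autEquivPow E (cyclotomic.irreducible_rat (by norm_num : 0 < 7))

/-- **`Frob₂ = 2 ∈ (ℤ/7)^×`.** -/
theorem autEquivPow_frob_two :
    galEquiv (T5FrobeniusGenerates.frob Nat.prime_two P) = ZMod.unitOfCoprime 2 (by decide) :=
  T5CyclotomicFrobenius.autEquivPow_frob Nat.prime_two P (by decide)

/-- `2 ∈ (ℤ/7)^×` has order `3`. -/
theorem orderOf_two_zmod_seven : orderOf (ZMod.unitOfCoprime 2 (by decide) : (ZMod 7)ˣ) = 3 :=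
  (orderOf_eq_iff (by norm_num)).mpr ⟨by decide, by decide⟩

/-- `−1 ∈ (ℤ/7)^×` has order `2`. -/
theorem orderOf_neg_one_zmod_seven : orderOf (-1 : (ZMod 7)ˣ) = 2 :=
  (orderOf_eq_iff (by norm_num)).mpr ⟨by decide, by decide⟩

/-- **`Frob₂` has order `3`** in `Gal(E/ℚ)`. -/
theorem orderOf_frob_two : orderOf (T5FrobeniusGenerates.frob Nat.prime_two P) = 3 := by
  rw [← orderOf_injective (galEquiv (E := E)).toMonoidHom (galEquiv (E := E)).injective,
    MulEquiv.coe_toMonoidHom, autEquivPow_frob_two, orderOf_two_zmod_seven]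

/-- **`|D₂| = 3`**: the decomposition group of a prime above `2` has `3` elements
(`e = 1`, `f = 3`). -/
theorem card_stabilizer_two : Nat.card (MulAction.stabilizer Gal(E/ℚ) P) = 3 := by
  rw [T5DecompositionOrder.card_stabilizer_eq_ramificationIdx_mul_inertiaDeg Nat.prime_two P,
    T5CyclotomicDyadic.ramificationIdx_two_seven E P, T5CyclotomicDyadic.inertiaDeg_two_seven E P]

/-- The complex conjugation of `ℚ(ζ₇)`: the automorphism `ζ ↦ ζ⁻¹`, i.e. `−1 ∈ (ℤ/7)^×`. -/
noncomputable abbrev conj : Gal(E/ℚ) := (galEquiv (E := E)).symm (-1)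

omit [IsGalois ℚ E] in
/-- The conjugation has order `2`. -/
theorem orderOf_conj : orderOf (conj (E := E)) = 2 := by
  rw [← orderOf_injective (galEquiv (E := E)).toMonoidHom (galEquiv (E := E)).injective,
    MulEquiv.coe_toMonoidHom, conj, MulEquiv.apply_symm_apply, orderOf_neg_one_zmod_seven]

omit [IsGalois ℚ E] in
/-- `Gal(ℚ(ζ₇)/ℚ)` is cyclic (it is `(ℤ/7)^×`). -/
theorem isCyclic_gal : IsCyclic Gal(E/ℚ) :=
  haveI : Fact (Nat.Prime 7) := ⟨by norm_num⟩
  isCyclic_of_surjective (galEquiv (E := E)).symm.toMonoidHom (galEquiv (E := E)).symm.surjective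

/-- **`c = −1 ∉ D₂`**: the conjugation is not in the decomposition group of a prime above `2`
(row N2.2.5's `D₂ = {1, 2, 4} ∌ −1`), because `|D₂| = 3` is odd. -/
theorem conj_notMem_stabilizer_two : conj (E := E) ∉ MulAction.stabilizer Gal(E/ℚ) P := by
  haveI := isCyclic_gal (E := E)
  rw [T5DecompositionOrder.mem_iff_two_dvd_card (orderOf_conj (E := E)), card_stabilizer_two P]
  decide

end Summit.Ventures.HodgeRepro2.T5CyclotomicSevenFrobenius
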